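import Literature.NumberTheory.Rogawski1990.UnitOrbitalIntegralInertValueTHCounts            -- ★ B-p12 p842134: counts-abstract `T_H` value
import Literature.NumberTheory.Rogawski1990.UnitOrbitalIntegralInertCountTHBoundary          -- ★∕pending B-p12 p842149: Prop. 10 boundary `A = b₀`
import Literature.NumberTheory.Rogawski1990.UnitOrbitalIntegralInertValueThetaOneClosed      -- ★ A-p03: `subgroupOf_flickerHK_eq`
import Literature.NumberTheory.Automorphic.UnitaryThreeFixedPointsCountRamified               -- ★ B-p04 (F3c-C9-θ′) `…_eq_finsum''`
import HarnessLib

/-!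
# LAYER C, `T_H` clause, BOUNDARY `A = b₀` (`tr δ = 3u`): `#{q ∈ U⧸K : t′ q = q} = phiTHM q (N+1) N`, binder-free
(Flicker (1998), Prop. 5 p. 82, Cor. 9 p. 85, Prop. 10 p. 85, Prop. 11 p. 87)

Topic `NumberTheory/Rogawski1990`; namespace `Literature.NumberTheory.Automorphic.UnitaryGroup`.  THEOREMS ONLY; kernel lane.  Cell `pub/hodgecm-mathlib`, road
«N7-ns COUNT FROM FLICKER», line «N7nsCount», `stub_irredGValuePos` (κ = +1): REPAIR (R1) of the GAP OF RECORD 07:09:11Z (B-p12; architect A-p06 (g26) 07:09:45Z;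
LEAD F0P3a-plan (g9) T8-127 (2)) — the companion of ★ A-p03 (g24) `natCard_fixedPoints_unitaryInt_ramifiedTorus_eq_phiTHM_final` (p841959, hypothesis
`|A − b₀| = |ϖ^{N₊}|`) on the complementary locus `A = b₀`, where the value is `phiTHM q (N+1) N` (= `phiTHn q (2N+1) N`, ★ (P2) p841969): ★ B-p12
`…_eq_phiTHM_of_counts` ∘ {★ B-p04 `natCard_fixedPoints_ramifiedTorus_eq_finsum''` (Cor. 9 at the ramified torus, weight′ + Mars discharged), B-p12
`natCard_cosets_ramifiedTorus_{even,odd}_eq_iTen_of_eq` (Prop. 10 boundary, `N₊ := N + 1`)}.  The :1189 closer is then `by_cases hAb : A = b₀` over the two ★ heads.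
HONEST LABEL: HC_CM is proved only modulo the printed citations (2 remaining named inputs hLiu418, h413) until rung 0 closes.

## References
* [Flicker1998UnitaryFL] Y. Z. Flicker, *Elementary proof of the fundamental lemma for a unitary group*, Canad. J. Math. 50 (1998): Prop. 5 p. 82, Prop. 6 p. 83,
  Cor. 9 p. 85, Prop. 10 p. 85, Prop. 11 p. 87.
* [Rogawski1990] J. D. Rogawski, *Automorphic Representations of Unitary Groups in Three Variables* (1990), §4.9 p. 55.
-/

set_option autoImplicit false

open scoped MatrixGroups WithZero Valued
open Matrix

universe u

namespace Literature.NumberTheory.Automorphic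

namespace UnitaryGroup

open Literature.NumberTheory.Automorphic.HermitianLattice (unitaryInt mem_unitaryInt_iff LocalConjDatum)
open Literature.NumberTheory.Rogawski1990.Flicker1998 (iTen phiTHM)
open IsLocalRing

variable {K : Type*} [Field K] [Valued K ℤᵐ⁰] {ϖ : K} (σ : K →+* K) {J : Matrix (Fin 3) (Fin 3) K}

section THBoundary

variable [IsDiscreteValuationRing 𝒪[K]] [Finite (ResidueField 𝒪[K])]

set_option synthInstance.maxHeartbeats 200000 in
-- the `H`-action on `H ⧸ (K^{u_m} ∩ H)` is found through the large subgroup terms of the `U(2,1)` frame (as in ★ (F2))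
/-- **κ = +1 (`T_H`) VALUE ON THE BOUNDARY `A = b₀`, binder-free**: `#{q ∈ U⧸K : t′ q = q} = phiTHM q (N+1) N` for B-p12's ramified-torus literal `t′ = !![A,0,Cρ;0,b₀,0;C,0,A]`
with `A = b₀` (`tr t′ = 3b₀`; `|ρ| = |ϖ|`, `|C| = |ϖ^N|`) and representatives `r`, over the lattice bridge `(R, ι, σR, dR, ϖR)` — the clause ★ p841959 cannot state
(`N₊ = ∞`). [cite: Flicker1998UnitaryFL, Prop. 5 p. 82, Cor. 9 p. 85, Prop. 10 p. 85, Prop. 11 p. 87] -/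
theorem natCard_fixedPoints_unitaryInt_ramifiedTorus_eq_phiTHM_final_of_eq (hJ : J = (StdForm.antidiagonal 3).over K) (hd : LocalConjDatum σ ϖ)
    (hσO : ∀ y : 𝒪[K], (σ.comp 𝒪[K].subtype) y ∈ 𝒪[K]) {y : K} (hy : y * σ y = -2)
    {c : ↥(unitaryGroupOfForm σ J)} (hc : ((c : GL (Fin 3) K) : Matrix (Fin 3) (Fin 3) K) = !![1, 0, 0; 0, -1, 0; 0, 0, 1])
    (u : ℕ → ↥(unitaryGroupOfForm σ J))
    (hu : ∀ m, ((u m : GL (Fin 3) K) : Matrix (Fin 3) (Fin 3) K) = !![ϖ ^ m, y, (ϖ ^ m)⁻¹; 0, 1, -σ y * (ϖ ^ m)⁻¹; 0, 0, (ϖ ^ m)⁻¹])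
    {R : Type u} [CommRing R] [IsDomain R] [IsDiscreteValuationRing R] [IsAdicComplete (IsLocalRing.maximalIdeal R) R]
    (ι : R →+* K) (hι : Function.Injective ι)
    (hιv : ∀ x : K, Valued.v x ≤ 1 ↔ x ∈ Set.range ι) (σR : R →+* R) (hσR : ∀ r, σR (σR r) = r) (hσι : ∀ r, ι (σR r) = σ (ι r))
    {dR : R} (hdRσ : σR dR = -dR) (hdRu : IsUnit dR) (h2R : IsUnit (2 : R)) {ϖR : R} (hϖR : Irreducible ϖR) (hιϖ : ι ϖR = ϖ)
    {ρ : K} (hvρ : Valued.v ρ = Valued.v ϖ)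
    {t : ↥(unitaryGroupOfForm σ J)} {A B C b₀ : K} (hte : ((t : GL (Fin 3) K) : Matrix (Fin 3) (Fin 3) K) = !![A, 0, B; 0, b₀, 0; C, 0, A])
    (htH : t ∈ Subgroup.centralizer ({c} : Set ↥(unitaryGroupOfForm σ J))) (hBC : B = C * ρ)
    (r : ℕ → ↥(Subgroup.centralizer ({c} : Set ↥(unitaryGroupOfForm σ J))))
    (hr0 : ∀ a : ℕ, (((r (2 * a) : ↥(unitaryGroupOfForm σ J)) : GL (Fin 3) K) : Matrix (Fin 3) (Fin 3) K) = !![(ϖ ^ a)⁻¹, 0, 0; 0, 1, 0; 0, 0, ϖ ^ a])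
    (hr1 : ∀ a : ℕ, (((r (2 * a + 1) : ↥(unitaryGroupOfForm σ J)) : GL (Fin 3) K) : Matrix (Fin 3) (Fin 3) K) =
      !![0, 0, ϖ ^ (a + 1) / ι dR; 0, 1, 0; -ι dR * (ϖ ^ (a + 1))⁻¹, 0, 0])
    {N : ℕ} (hvC : Valued.v C = Valued.v (ϖ ^ N)) (hAb : A = b₀)
    {q : ℕ} (hq : Nat.card (ResidueField 𝒪[K]) = q ^ 2) (hqR : Nat.card (ResidueField R) = q ^ 2) (hq1 : 1 < q)
    {a₀ : 𝒪[K]} (ha₀ : IsUnit (((σ.comp 𝒪[K].subtype).codRestrict 𝒪[K] hσO) a₀ - a₀))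
    (hfin : {x : ↥(unitaryGroupOfForm σ J) ⧸ unitaryInt σ J | t • x = x}.Finite) :
    (Nat.card {x : ↥(unitaryGroupOfForm σ J) ⧸ unitaryInt σ J | t • x = x} : ℚ) = phiTHM q (N + 1) N := by
  have hϖ0 : ϖ ≠ 0 := hd.ϖ_ne_zero
  have hC : C ≠ 0 := fun h => by rw [h, map_zero] at hvC; exact (pow_ne_zero _ hϖ0) ((map_eq_zero _).1 hvC.symm)
  have hvd : Valued.v (ι dR) = 1 := v_map_eq_one_of_isUnit ι hιv hdRu
  refine natCard_fixedPoints_unitaryInt_ramifiedTorus_eq_phiTHM_of_counts σ hJ hd hy hc u hu hte htH hBC hvρ hvd r hr0 hr1 hvC hq1 hfin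
    (fun m => ?_) (fun n m hn => ?_)
  · -- Cor. 9 at the ramified torus (★ B-p04, weight′ + Mars discharged by ★ B-p12)
    have hS := subgroupOf_flickerHK_eq σ c (u m)
    have hfinm : {x : ↥(Subgroup.centralizer ({c} : Set ↥(unitaryGroupOfForm σ J))) ⧸
        (flickerHK σ J c (u m)).subgroupOf (Subgroup.centralizer ({c} : Set ↥(unitaryGroupOfForm σ J))) |
          (⟨t, htH⟩ : ↥(Subgroup.centralizer ({c} : Set ↥(unitaryGroupOfForm σ J)))) • x = x}.Finite := by
      rw [hS]; exact Set.finite_coe_iff.1 ((finite_setOf_nonempty_fixedPoints_flickerU σ hJ hd hy hc u hu htH hfin).2 m)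
    have h9 := natCard_fixedPoints_ramifiedTorus_eq_finsum'' σ hJ hd hy m (hu m) ι hι hιv σR hσR hσι hdRσ hdRu h2R hϖR hιϖ hqR hc hvρ htH hte hC
      hBC r hr0 hr1 hfinm
    rw [hS] at h9
    exact h9
  · -- Prop. 10 on the boundary, per representative, with `N₊ := N + 1`
    obtain ⟨a, rfl | rfl⟩ := Nat.even_or_odd' n
    · exact natCard_cosets_ramifiedTorus_even_eq_iTen_of_eq σ hJ hd hσO hy hc (hu m) hte htH hBC hvρ (hr0 a) (r (2 * a)).2 hvC hAb le_rfl hn hq ha₀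
    · exact natCard_cosets_ramifiedTorus_odd_eq_iTen_of_eq σ hJ hd hσO hy hc (hu m) hte htH hBC hvρ hvd (hr1 a) (r (2 * a + 1)).2 hvC hAb le_rfl hn hq ha₀

end THBoundary

end UnitaryGroup

end Literature.NumberTheory.Automorphic
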